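import Summits.BirchSwinnertonDyer.BirchSwinnertonDyer.Theorems.ClassRecordThreeCornerTwistWitnessReplays
import Summits.BirchSwinnertonDyer.BirchSwinnertonDyer.Theorems.ClassRecordThreeKernelUpperB
import HarnessLib

/-!
# Routes `ClassRecordThree` / `KolyvaginRoadThree` (rung K2@3), crux 7 `CornerAtThree` (item
# stmt-BirchSwinnertonDyer-19111): the two `closes` kernels RE-GLUED through the ∃-recut `CornerTwistWitnessAt` of the
# (Tw) conjunct — one-token twins of `ClassRecordThreeKernelUpperB` (cell `bsd-stepL`, seat `bsd-stepL-mult-p3` g4;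
# plan g37 RULING 33 STEP 1 — kernel part)

`--supports stmt-BirchSwinnertonDyer-19111 --as helper`. Theorems only; no definition, no named fact, no `sorry`; imports NO
Theses file and NO `Cruxes/` file. NO new mathematics beyond the companions' replays
(`Theorems/ClassRecordThreeCornerTwistWitnessDefs.lean`: the predicate `CornerTwistWitness.CornerTwistWitnessAt` and its
soundness `cornerTwistWitnessAt_of_cornerTwistAt`; `Theorems/ClassRecordThreeCornerTwistWitnessReplays.lean`: the three
corner consumers of (Tw) replayed at the supplied field).

## What this file does

`Theorems/ClassRecordThreeKernelUpperB.lean` (the terms both routes' `closes` call) consumes the corner's (Tw) conjunct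
`hCT : ∀ W, X11b.Three.CornerTwistAt W` (the rank-`0` `3`-part of BSD for EVERY odd Heegner twist of a (T4″)@3 corner pair)
at exactly three sites each (l. 166 ∕ 171 ∕ 173 and l. 276 ∕ 281 ∕ 283), every one of which applies it at ONE field chosen
by `exists_oddHeegnerData` (plan g37 RULING 33 FINDING: (Tw) is consumed ONLY EXISTENTIALLY). Here:

* §1 `multiplicativeRankOneAtThree_of_classRecord_upperB_of_twistWitness` — `…_of_classRecord_upperB` VERBATIM with `hCT` ↦
  `hCW : ∀ W, CornerTwistWitness.CornerTwistWitnessAt W` (ONE odd Heegner twin per pair: `d_K < -4`, Heegner for `N_E` and `3`,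
  `L(E^{d_K},1) ≠ 0`, a global minimal twist model `Wd` with `BSDp Wd 3`) and the corner branch re-glued as ONE call of
  `CornerTwistWitness.missingPPartAt_of_corner_of_witness` (the split(3) dichotomy of the pass-through wrappers is not needed;
  (U♯) enters through `CornerTwistWitness.missingUpperBoundAt_of_cornerUpperAt_of_cornerTwistWitnessAt`);
* §2 `multiplicativeRankOneAtThree_of_kolyRecord_upperB_of_twistWitness` — the same for the KOLY record.

So the planner's 1:1 restate of item 19111's middle conjunct (RULING 33 STEP 2: `X11b.Three.CornerTwistAt W` ↦
`Theorems.CornerTwistWitness.CornerTwistWitnessAt W`, STRICTLY WEAKER) re-certifies both `closes` by the one-token edit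
`…_upperB ↦ …_upperB_of_twistWitness`; every other item, binder and both theses are unchanged.

HONEST FRAMING: kernel re-plumbing; CONDITIONAL on every binder (named published facts + the routes' typed inputs); nothing
booked; no census word, tier or label moves (T7); O2 stays OPEN; BSD(E,3) is proved for no class by this file.

References: those of `ClassRecordThreeKernelUpperB.lean` — [Castella2018] Thm. 2.3, Thm. 3.2, §5; [Skinner2016PacificMC]
Thm. A, Thm. C; [SteinWuthrich2013] Thm. 6.1; [Disegni2020] Thm. 1; [MatarNekovar2019] Thm. 0.3; [Hsieh2014] Thm. 1;
[McCallumLMS1991] Cor. 5.6; [Wuthrich2014] Prop. 21; [Miller2011LMS] Def. 1.1; cell board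
`run/shared/lean/pub/bsd-stepL/STATUS.md` RULING 33 (2026-08-27T18:14Z).
-/

noncomputable section

open scoped Classical

open WeierstrassCurve NumberField IsDedekindDomain Field Literature.NumberTheory.EllipticCurves
  Rat.HeightOneSpectrum
  Literature.NumberTheory.DiophantineGeometry
  Literature.NumberTheory.EllipticCurves.GreenbergSelmer
  Literature.NumberTheory.EllipticCurves.ModularForms
  Literature.NumberTheory.EllipticCurves.Rank1Residual
  Literature.NumberTheory.EllipticCurves.Rank1Residual.Typed
  Literature.NumberTheory.EllipticCurves.Wuthrich2014
  Literature.NumberTheory.EllipticCurves.BalakrishnanEtAl2019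
  Literature.NumberTheory.EllipticCurves.Skinner2016
  Literature.NumberTheory.EllipticCurves.SteinWuthrich2013
  Literature.NumberTheory.EllipticCurves.Disegni2020
  Literature.NumberTheory.EllipticCurves.BarriosEtAl2025
  Literature.NumberTheory.QuadraticFields.Quadratic
  Literature.NumberTheory.Automorphic
  Literature.NumberTheory.GaloisRepresentations Literature.NumberTheory.GaloisCohomology
  Summit.BirchSwinnertonDyer.Rank1Residual.X11b.AcSelmer
  Summit.BirchSwinnertonDyer.Rank1Residual.X11b.LocBridge
  Summit.BirchSwinnertonDyer.Rank1Residual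
  Summit.BirchSwinnertonDyer.Rank1Residual.X11b
  Summit.BirchSwinnertonDyer.Rank1Residual.X11b.Three

-- the cell's Theorems namespace repeats the summit name (Summit.<Summit>.<Problem>), as in every sibling file
set_option linter.dupNamespace false

namespace Summit.BirchSwinnertonDyer.BirchSwinnertonDyer.Theorems

/-! ### §1. The K2@3 `closes` kernel from the class record, corner re-glued through the twin WITNESS -/

/-- **K2@3 `closes` kernel from the class record (H3 ORIENTED), with the corner's (Tw) conjunct RE-CUT to ONE twin.**
`multiplicativeRankOneAtThree_of_classRecord_upperB` VERBATIM except that the corner binder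
`hCT : ∀ W, X11b.Three.CornerTwistAt W` (the rank-`0` `3`-part of BSD for EVERY odd Heegner twist) is replaced by
`hCW : ∀ W, CornerTwistWitness.CornerTwistWitnessAt W` (ONE odd Heegner twin per corner pair, `d_K < -4`, `3` split,
`L(E^{d_K},1) ≠ 0`, `BSDp Wd 3` — STRICTLY WEAKER, `CornerTwistWitness.cornerTwistWitnessAt_of_cornerTwistAt`), and the
corner branch (`¬Ram ∧ ¬Surj`) is ONE call of `CornerTwistWitness.missingPPartAt_of_corner_of_witness` at the witness (STEP L
`hCL`, (U♯) `hCU` through `CornerTwistWitness.missingUpperBoundAt_of_cornerUpperAt_of_cornerTwistWitnessAt`, Matar–Nekovář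
`hMN` off the Tamagawa cells) — the split(3) dichotomy of the pass-through wrappers `…_split_of_inputs` ∕ `…_nonsplit_of_inputs`
is not needed. Roads (a), (b), (d) and every other binder byte-identical. CONDITIONAL on every binder; nothing booked;
O2 OPEN; no census word, tier or label moves.
-- adapted from Summits/BirchSwinnertonDyer/BirchSwinnertonDyer/Theorems/ClassRecordThreeKernelUpperB.lean (§1)
[cite: Castella2018, Thm. 2.3 (p. 5), Thm. 3.2 (p. 9), §5 (p. 12)] [cite: Skinner2016PacificMC, Thm. A and Thm. C (§1)]
[cite: SteinWuthrich2013, Thm. 6.1, §4.2] [cite: Disegni2020, Thm. 1 (§1.2)] [cite: MatarNekovar2019, Thm. 0.3 (p. 456)]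
[cite: Hsieh2014, Thm. 1 (arXiv:1112.1580 pp. 3–4)] [cite: Wuthrich2014, Prop. 21 (p. 400)] [cite: Miller2011LMS, Def. 1.1] -/
theorem multiplicativeRankOneAtThree_of_classRecord_upperB_of_twistWitness
    -- PUBLISHED: the named facts of route p2, WITHOUT `hEP` (as v4.5′)
    (hGZ : ∀ (N : ℕ) [NeZero N] (W : WeierstrassCurve ℚ) (K : Type) [Field K] [NumberField K],
      gross_zagier N W K)
    (hKo : ∀ (N : ℕ) [NeZero N] (W : WeierstrassCurve ℚ) (K : Type) [Field K] [NumberField K],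
      kolyvagin N W K)
    (hB : ∀ (N : ℕ) [NeZero N] (W : WeierstrassCurve ℚ) (K : Type) [Field K] [NumberField K],
      Kolyvagin1990_padicValNat_card_sha_le N W K)
    (hSk : Skinner2016.thmC_padicValRat_bsd_rank_zero) (hWu : sha_dvd_analyticSha)
    (hGZK : rank_eq_analyticRank_of_analyticRank_le_one) (hmod : hasEntireLFunction_rat)
    (hnf : exists_isNewformOf) (hHL : HoffsteinLuo1997_exists_twist_L_one_ne_zero)
    (hMaz : mazur_not_dvd_maninConstant_of_odd)
    (hPT : ∀ (K : Type) [Field K] [NumberField K], poitouTate_sum_localTatePairing_eq_zero K)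
    -- PUBLISHED: road (a)'s five, Matar–Nekovář 2019 Thm. 0.3, Hsieh 2014 Thm. 1 (NO `hFH`, NO `hBR`)
    (hSkA : thmA_charIdeal_multiplicative) (hJn : thm61_nonsplitMultiplicative)
    (hHn : exists_isMultCanonical) (hD : thm1_padicBSD_rankOne_multiplicative)
    (hpar : nonempty_modularParametrizationData)
    (hMN : ∀ (N : ℕ) [NeZero N] (W : WeierstrassCurve ℚ) (K : Type) [Field K] [NumberField K],
      MatarNekovar2019.thm03_padicValNat_card_sha_le_of_irreducible N W K)
    (hH : hsieh2014_exists_anticyclotomicPAdicLFunction)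
    -- ROAD (a) NONSPLIT(3) ∧ (ram): Schneider at 3
    (hReg : ∀ (W : WeierstrassCurve ℚ) [W.IsElliptic] [W.IsGloballyMinimal],
      ClassX11b W 3 → Ram W 3 → ¬ W.HasSplitMultiplicativeReductionAtPrime 3 →
        ClassClosure.RegulatorNonvanishingAt W 3)
    -- ROADS (b)/(d): the named descent residual …
    (hDb : ∀ (W : WeierstrassCurve ℚ) [W.IsElliptic] [W.IsGloballyMinimal],
      ClassX11b W 3 → Ram W 3 → W.HasSplitMultiplicativeReductionAtPrime 3 → HsiehDescentAt₃ W)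
    (hDd : ∀ (W : WeierstrassCurve ℚ) [W.IsElliptic] [W.IsGloballyMinimal],
      ClassX11b W 3 → ¬ Ram W 3 → Surj W 3 → HsiehDescentAt₃ W)
    -- … and the halves H2 ∧ H3
    (hHb : ∀ (W : WeierstrassCurve ℚ) [W.IsElliptic] [W.IsGloballyMinimal],
      ClassX11b W 3 → Ram W 3 → W.HasSplitMultiplicativeReductionAtPrime 3 →
        BDPValueAt₃ W ∧ IMCDivAt₃B W)
    (hHd : ∀ (W : WeierstrassCurve ℚ) [W.IsElliptic] [W.IsGloballyMinimal],
      ClassX11b W 3 → ¬ Ram W 3 → Surj W 3 → BDPValueAt₃ W ∧ IMCDivAt₃B W)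
    -- pure-(T2β)@3 on split ∧ (ram): the CONSUMED Euler-system half (replaces the displays binder `hSh`)
    (hUβ : ∀ (W : WeierstrassCurve ℚ) [W.IsElliptic] [W.IsGloballyMinimal],
      ClassX11b W 3 → Ram W 3 → W.HasSplitMultiplicativeReductionAtPrime 3 → ¬ ShapeAlpha W →
        ¬ ShapeGamma W → 3 ∣ W.tamagawaProduct → Typed.MissingUpperBoundAt W 3)
    -- (T2′)₃ Euler-system halves (α, γ∖α split, ¬ram)
    (hUα : ∀ (W : WeierstrassCurve ℚ) [W.IsElliptic] [W.IsGloballyMinimal],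
      ClassX11b W 3 → Ram W 3 → ShapeAlpha W → Typed.MissingUpperBoundAt W 3)
    (hUγ : ∀ (W : WeierstrassCurve ℚ) [W.IsElliptic] [W.IsGloballyMinimal],
      ClassX11b W 3 → Ram W 3 → W.HasSplitMultiplicativeReductionAtPrime 3 → ¬ ShapeAlpha W →
        ShapeGamma W → Typed.MissingUpperBoundAt W 3)
    (hU₀ : ∀ (W : WeierstrassCurve ℚ) [W.IsElliptic] [W.IsGloballyMinimal],
      ClassX11b W 3 → Surj W 3 → ¬ Ram W 3 → Typed.MissingUpperBoundAt W 3)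
    -- THE (T4″)₃ CORNER `¬Surj`
    (hCL : ∀ (W : WeierstrassCurve ℚ) [W.IsElliptic] [W.IsGloballyMinimal], CornerStepLAt W)
    (hCW : ∀ (W : WeierstrassCurve ℚ) [W.IsElliptic] [W.IsGloballyMinimal],
      CornerTwistWitness.CornerTwistWitnessAt W)
    (hCU : ∀ (W : WeierstrassCurve ℚ) [W.IsElliptic] [W.IsGloballyMinimal], CornerUpperAt W) :
    MultiplicativeRankOneAtThree := by
  intro W _ _ hX
  have hEP : ∀ (K : Type) [Field K] [NumberField K] (v : HeightOneSpectrum (𝓞 K)),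
      localEulerPoincareCharacteristic (v.adicCompletion K) :=
    GaloisImage.EP.localEulerPoincareCharacteristic_adicCompletion
  by_cases hram : Ram W 3
  · by_cases hs : W.HasSplitMultiplicativeReductionAtPrime 3
    · -- road (b): StepLAt W from the named descent residual + H2 ∧ H3 at W
      have hL : StepLAt W :=
        stepLAt_of_halves₃_of_classX11bB hnf hKo hPT hEP hX
          (bdpExistsAt₃_of_hsieh2014_of_descent W hH lambdaSupplyAt₃ (hDb W hX hram hs))
          (hHb W hX hram hs).1 (hHb W hX hram hs).2
      exact Three.bsdp_three_of_surj_of_stepLAt_of_shapes_upper hGZ hKo hB hSk hWu hGZK hmod hnf hHL hMaz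
        hPT hEP W hX (surj_of_irr_of_ram W 3 hX.2.2.2 hram) hL
        (fun hram hα hγ ht ↦ hUβ W hX hram hs hα hγ ht) (fun hram hα ↦ hUα W hX hram hα)
        (fun hram hα hγ ↦ hUγ W hX hram hs hα hγ) (fun h ↦ absurd hram h)
    · -- road (a)
      exact bsdp_of_ram_of_nonsplit_of_regulatorNonvanishing hSkA hJn hHn hD hGZK hpar W 3 hX hram hs
        (hReg W hX hram hs)
  · by_cases hsurj : Surj W 3
    · -- road (d)
      have hL₀ : StepLAt W :=
        stepLAt_of_halves₃_of_classX11bB hnf hKo hPT hEP hX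
          (bdpExistsAt₃_of_hsieh2014_of_descent W hH lambdaSupplyAt₃ (hDd W hX hram hsurj))
          (hHd W hX hram hsurj).1 (hHd W hX hram hsurj).2
      exact Three.bsdp_three_of_surj_of_stepLAt_of_shapes_upper hGZ hKo hB hSk hWu hGZK hmod hnf hHL hMaz
        hPT hEP W hX hsurj hL₀ (fun h _ _ _ ↦ absurd h hram) (fun h _ ↦ absurd h hram)
        (fun h _ _ ↦ absurd h hram) (fun _ ↦ hU₀ W hX hsurj hram)
    · -- the corner: ONE call at the twin WITNESS ((U♯) on the Tamagawa cells via §1's upper replay)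
      refine Typed.bsdp_of_missingPPartAt W 3 hGZK (by rw [hX.1]) ?_
      exact CornerTwistWitness.missingPPartAt_of_corner_of_witness hGZ hKo hGZK hmod hnf hMaz hPT hEP hMN W hX
        hsurj (hCL W) (hCW W) (fun ht ↦
          CornerTwistWitness.missingUpperBoundAt_of_cornerUpperAt_of_cornerTwistWitnessAt hGZ hKo hGZK hmod hnf
            hMaz W hX hsurj ht (hCU W) (hCW W))

/-! ### §2. The K2@3 `closes` kernel from the KOLY record, corner re-glued through the twin WITNESS -/

/-- **K2@3 `closes` kernel from the KOLY RECORD (H3 ORIENTED), with the corner's (Tw) conjunct RE-CUT to ONE twin.**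
`multiplicativeRankOneAtThree_of_kolyRecord_upperB` VERBATIM except `hCT : ∀ W, CornerTwistAt W` ↦
`hCW : ∀ W, CornerTwistWitness.CornerTwistWitnessAt W` and the corner branch re-glued as ONE call of
`CornerTwistWitness.missingPPartAt_of_corner_of_witness` at the witness (as in §1). Every other binder byte-identical (the
Kolyvagin road `hA1` on A1; road (a) `hReg`; `hDb`, `hHb`, `hUβ`, `hUα`, `hUγ`, `hDd`, `hHd`, `hU₀`; corner `hCL`, `hCU`).
CONDITIONAL on every binder; nothing booked; O2 OPEN.
-- adapted from Summits/BirchSwinnertonDyer/BirchSwinnertonDyer/Theorems/ClassRecordThreeKernelUpperB.lean (§2)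
[cite: Castella2018, Thm. 2.3 (p. 5), Thm. 3.2 (p. 9), §5 (p. 12)] [cite: Skinner2016PacificMC, Thm. A and Thm. C (§1)]
[cite: McCallumLMS1991, §5 Cor. 5.6 (p. 310)] [cite: MatarNekovar2019, Thm. 0.3 (p. 456)] -/
theorem multiplicativeRankOneAtThree_of_kolyRecord_upperB_of_twistWitness
    -- PUBLISHED: the named facts of route p2, WITHOUT `hEP` (as v4.5′)
    (hGZ : ∀ (N : ℕ) [NeZero N] (W : WeierstrassCurve ℚ) (K : Type) [Field K] [NumberField K],
      gross_zagier N W K)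
    (hKo : ∀ (N : ℕ) [NeZero N] (W : WeierstrassCurve ℚ) (K : Type) [Field K] [NumberField K],
      kolyvagin N W K)
    (hB : ∀ (N : ℕ) [NeZero N] (W : WeierstrassCurve ℚ) (K : Type) [Field K] [NumberField K],
      Kolyvagin1990_padicValNat_card_sha_le N W K)
    (hSk : Skinner2016.thmC_padicValRat_bsd_rank_zero) (hWu : sha_dvd_analyticSha)
    (hGZK : rank_eq_analyticRank_of_analyticRank_le_one) (hmod : hasEntireLFunction_rat)
    (hnf : exists_isNewformOf) (hHL : HoffsteinLuo1997_exists_twist_L_one_ne_zero)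
    (hMaz : mazur_not_dvd_maninConstant_of_odd)
    (hPT : ∀ (K : Type) [Field K] [NumberField K], poitouTate_sum_localTatePairing_eq_zero K)
    -- PUBLISHED: road (a)'s five, Matar–Nekovář 2019 Thm. 0.3, Hsieh 2014 Thm. 1 (NO `hFH`, NO `hBR`)
    (hSkA : thmA_charIdeal_multiplicative) (hJn : thm61_nonsplitMultiplicative)
    (hHn : exists_isMultCanonical) (hD : thm1_padicBSD_rankOne_multiplicative)
    (hpar : nonempty_modularParametrizationData)
    (hMN : ∀ (N : ℕ) [NeZero N] (W : WeierstrassCurve ℚ) (K : Type) [Field K] [NumberField K],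
      MatarNekovar2019.thm03_padicValNat_card_sha_le_of_irreducible N W K)
    (hH : hsieh2014_exists_anticyclotomicPAdicLFunction)
    -- THE KOLYVAGIN ROAD on A1 = (ram) ∧ 3 ∤ ∏c
    (hA1 : ∀ (W : WeierstrassCurve ℚ) [W.IsElliptic] [W.IsGloballyMinimal],
      ClassX11b W 3 → Ram W 3 → ¬ 3 ∣ W.tamagawaProduct → BSDp W 3)
    -- ROAD (a) NONSPLIT(3) ∧ (ram) ∧ 3 ∣ ∏c: Schneider at 3, RESTRICTED to the Tamagawa cells
    (hReg : ∀ (W : WeierstrassCurve ℚ) [W.IsElliptic] [W.IsGloballyMinimal],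
      ClassX11b W 3 → Ram W 3 → ¬ W.HasSplitMultiplicativeReductionAtPrime 3 → 3 ∣ W.tamagawaProduct →
        ClassClosure.RegulatorNonvanishingAt W 3)
    -- ROAD (b) SPLIT(3) ∧ (ram): the named descent residual …
    (hDb : ∀ (W : WeierstrassCurve ℚ) [W.IsElliptic] [W.IsGloballyMinimal],
      ClassX11b W 3 → Ram W 3 → W.HasSplitMultiplicativeReductionAtPrime 3 → HsiehDescentAt₃ W)
    -- … and the halves H2 ∧ H3, RESTRICTED to the Tamagawa cells
    (hHb : ∀ (W : WeierstrassCurve ℚ) [W.IsElliptic] [W.IsGloballyMinimal],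
      ClassX11b W 3 → Ram W 3 → W.HasSplitMultiplicativeReductionAtPrime 3 → 3 ∣ W.tamagawaProduct →
        BDPValueAt₃ W ∧ IMCDivAt₃B W)
    -- pure-(T2β)@3 on split ∧ (ram): the CONSUMED Euler-system half (replaces the displays binder `hSh`)
    (hUβ : ∀ (W : WeierstrassCurve ℚ) [W.IsElliptic] [W.IsGloballyMinimal],
      ClassX11b W 3 → Ram W 3 → W.HasSplitMultiplicativeReductionAtPrime 3 → ¬ ShapeAlpha W →
        ¬ ShapeGamma W → 3 ∣ W.tamagawaProduct → Typed.MissingUpperBoundAt W 3)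
    -- (T2′)₃ Euler-system halves (as v4.5′)
    (hUα : ∀ (W : WeierstrassCurve ℚ) [W.IsElliptic] [W.IsGloballyMinimal],
      ClassX11b W 3 → Ram W 3 → ShapeAlpha W → Typed.MissingUpperBoundAt W 3)
    (hUγ : ∀ (W : WeierstrassCurve ℚ) [W.IsElliptic] [W.IsGloballyMinimal],
      ClassX11b W 3 → Ram W 3 → W.HasSplitMultiplicativeReductionAtPrime 3 → ¬ ShapeAlpha W →
        ShapeGamma W → Typed.MissingUpperBoundAt W 3)
    -- ROAD (d) `¬Ram ∧ Surj` (as v4.5′)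
    (hDd : ∀ (W : WeierstrassCurve ℚ) [W.IsElliptic] [W.IsGloballyMinimal],
      ClassX11b W 3 → ¬ Ram W 3 → Surj W 3 → HsiehDescentAt₃ W)
    (hHd : ∀ (W : WeierstrassCurve ℚ) [W.IsElliptic] [W.IsGloballyMinimal],
      ClassX11b W 3 → ¬ Ram W 3 → Surj W 3 → BDPValueAt₃ W ∧ IMCDivAt₃B W)
    (hU₀ : ∀ (W : WeierstrassCurve ℚ) [W.IsElliptic] [W.IsGloballyMinimal],
      ClassX11b W 3 → Surj W 3 → ¬ Ram W 3 → Typed.MissingUpperBoundAt W 3)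
    -- THE (T4″)@3 CORNER (as v4.5′)
    (hCL : ∀ (W : WeierstrassCurve ℚ) [W.IsElliptic] [W.IsGloballyMinimal], CornerStepLAt W)
    (hCW : ∀ (W : WeierstrassCurve ℚ) [W.IsElliptic] [W.IsGloballyMinimal],
      CornerTwistWitness.CornerTwistWitnessAt W)
    (hCU : ∀ (W : WeierstrassCurve ℚ) [W.IsElliptic] [W.IsGloballyMinimal], CornerUpperAt W) :
    MultiplicativeRankOneAtThree := by
  intro W _ _ hX
  have hEP : ∀ (K : Type) [Field K] [NumberField K] (v : HeightOneSpectrum (𝓞 K)),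
      localEulerPoincareCharacteristic (v.adicCompletion K) :=
    GaloisImage.EP.localEulerPoincareCharacteristic_adicCompletion
  by_cases hram : Ram W 3
  · by_cases htam : 3 ∣ W.tamagawaProduct
    · by_cases hs : W.HasSplitMultiplicativeReductionAtPrime 3
      · -- road (b) on the Tamagawa cells: StepLAt W from the named descent residual + H2 ∧ H3 at W
        have hL : StepLAt W :=
          stepLAt_of_halves₃_of_classX11bB hnf hKo hPT hEP hX
            (bdpExistsAt₃_of_hsieh2014_of_descent W hH lambdaSupplyAt₃ (hDb W hX hram hs))
            (hHb W hX hram hs htam).1 (hHb W hX hram hs htam).2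
        exact Three.bsdp_three_of_surj_of_stepLAt_of_shapes_upper hGZ hKo hB hSk hWu hGZK hmod hnf hHL hMaz
          hPT hEP W hX (surj_of_irr_of_ram W 3 hX.2.2.2 hram) hL
          (fun hram hα hγ ht ↦ hUβ W hX hram hs hα hγ ht) (fun hram hα ↦ hUα W hX hram hα)
          (fun hram hα hγ ↦ hUγ W hX hram hs hα hγ) (fun h ↦ absurd hram h)
      · -- road (a) on the Tamagawa cells
        exact bsdp_of_ram_of_nonsplit_of_regulatorNonvanishing hSkA hJn hHn hD hGZK hpar W 3 hX hram hs
          (hReg W hX hram hs htam)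
    · -- A1: the Kolyvagin road decides
      exact hA1 W hX hram htam
  · by_cases hsurj : Surj W 3
    · -- road (d), as v4.5′
      have hL₀ : StepLAt W :=
        stepLAt_of_halves₃_of_classX11bB hnf hKo hPT hEP hX
          (bdpExistsAt₃_of_hsieh2014_of_descent W hH lambdaSupplyAt₃ (hDd W hX hram hsurj))
          (hHd W hX hram hsurj).1 (hHd W hX hram hsurj).2
      exact Three.bsdp_three_of_surj_of_stepLAt_of_shapes_upper hGZ hKo hB hSk hWu hGZK hmod hnf hHL hMaz
        hPT hEP W hX hsurj hL₀ (fun h _ _ _ ↦ absurd h hram) (fun h _ ↦ absurd h hram)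
        (fun h _ _ ↦ absurd h hram) (fun _ ↦ hU₀ W hX hsurj hram)
    · -- the corner: ONE call at the twin WITNESS (as in §1 of this file)
      refine Typed.bsdp_of_missingPPartAt W 3 hGZK (by rw [hX.1]) ?_
      exact CornerTwistWitness.missingPPartAt_of_corner_of_witness hGZ hKo hGZK hmod hnf hMaz hPT hEP hMN W hX
        hsurj (hCL W) (hCW W) (fun ht ↦
          CornerTwistWitness.missingUpperBoundAt_of_cornerUpperAt_of_cornerTwistWitnessAt hGZ hKo hGZK hmod hnf
            hMaz W hX hsurj ht (hCU W) (hCW W))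


end Summit.BirchSwinnertonDyer.BirchSwinnertonDyer.Theorems

end
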